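import Literature.IUT.HodgeArakelov.LabelClassesOfCuspsCor24iH25Lift
import Literature.IUT.HodgeArakelov.LabelClassesOfCuspsCor24iProofs2
import Literature.IUT.HodgeTheaters.TemperedCoverings

/-!
# [IUTchII] Cor 2.4 (i): the input `h25` from [IUTchI] Cor 2.5 AT THE `X̲̲_v`-LEVEL (`Π_v ⊆ Π̂_v`), PROVED — structure-free

S. Mochizuki, *Inter-universal Teichmüller theory II*, kurims manuscript (Dec. 2020), §2, Def 2.3 (i)–(iii) pp. 67–68,
Cor 2.4 (i) pp. 69–71; *Inter-universal Teichmüller theory I*, kurims manuscript, Prop 2.4 (iii) p. 49, Cor 2.5 p. 51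
([IUTchII] Cor 2.4 (i), kurims pp.69-71) [claim: Mochizuki2012, status: disputed] (D-0012 claim key; series DISPUTED;
nothing printed is asserted — every [IUTchI] §2 input is a HYPOTHESIS, named by abc-iut-L5-t1's typed predicates).

PROOF-ONLY companion (no definitions) of `LabelClassesOfCusps` (abc-iut-L6-t1; node `IUTchII:Cor2.4(i)`, decls `Cor24_i`,
`Cor24_i'`), `LabelClassesOfCuspsCor24iProofs`/`…Proofs2` (abc-iut-w4-d012: `cor24_i_of_inputs`, `cor24_i'_of_inputs`) and
`LabelClassesOfCuspsCor24iH25Lift` (this seat: `PlusMinusTower.h25_of_hatLevel'`).  abc-iut cell, wave 5, seat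
abc-iut-w5-d132 (sequel to the RQ7 audit of the B13 bridge p412701 of abc-iut-L6-t7, finding F1).

WHY THE `X̲̲_v`-LEVEL.  In Cor 2.4 (i) `I_t ⊆ Π_v` is a cuspidal inertia group OF `Π_v = Π^tp_{X̲̲_v}` (p. 69 l. −6); by
Def 2.3 (iii) p. 68 ("`Π_⊆ ⊆ Π_⊇` corresponds to a totally ramified covering of curves") it is an index-`l` subgroup of
a cuspidal inertia group of `Π^±_v = Π^tp_{X̲_v}`, not itself one, so abc-iut-L5-t1's typed [IUTchI] Cor 2.5
(`StableCurveTemperedData.Cor25Inertia`, stated — as print, p. 51 — for FULL inertia groups of cusps) applies to `I_t`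
verbatim only for the curve `X̲̲_v` (`Π^tp = Π_v`, `Π̂ = Π̂_v`).  This file runs abc-iut-L6-t7's transport argument at that
level, WITHOUT a new structure (the identification is passed as explicit data):

* `PlusMinusTower.h25flat_of_hatData` — given an isomorphism `e : Π̂_v ⥲ Π̂_{X̲̲_v}` (of abstract groups) carrying
  `Π_v` onto the image of `Π^tp_{X̲̲_v} ↪ Π̂_{X̲̲_v}` and every `Π_v`-cuspidal inertia group (abc-iut-L6-t1's abstract
  `CuspidalInertiaData` at `Π_v`) onto a `Π^tp_{X̲̲_v}`-conjugate of a representative `I_x`, [IUTchI] Cor 2.5 for `X̲̲_v`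
  (`D♭.Cor25Inertia`, `Σ̂ = Primes`) and the normal terminality of `Π^tp_{X̲̲_v}` in `Π̂_{X̲̲_v}` (from `D♭.Prop24iii`) —
  BOTH HYPOTHESES — give (h♭): for `γ'' ∈ Δ̂_v`, `I^{γ''} ⊆ Π_v ⟹ γ'' ∈ Π_v`.  PROVED.
* `PlusMinusTower.h25_of_hatData` — hence, with `Π^±_v ∩ Π̂_v ⊆ Π_v` and `Δ^±_v ⊄ Δ̂_v` (two properties of the
  degree-`l` covering `X̲̲_v → X̲_v` of Def 2.3 (i), read off the common model), LITERALLY hypothesis `h25` of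
  `cor24_i_of_inputs` for the printed `I_t ⊆ Π_v` ("the inclusion `I^{γ'}_t ⊆ Π^±_v` implies that `γ' ∈ Δ^±_v`", p. 70).
* `cor24_i_of_hatData` / `cor24_i'_of_hatData` — the node predicate `Cor24_i W C H I` (any `Π_{v□}`) resp. the decl of
  record `Cor24_i' Dec W C Ld I` (printed family `□ ∈ {•t, ▶}`), from the `X̲̲_v`-level data + the two covering facts +
  the remaining printed inputs (B) `h23vi` (Cor 2.3 (vi) "applied to the various finite index open subgroups",
  GAP-LEDGER G-w4d012-2) and (C) `h23v` (Cor 2.3 (ii)+(v), = abc-iut-L6-t7's B13 `StableCurveAgreement.h23v` at the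
  `X̲_v`-level) as hypotheses.  PROVED.

Typed ≠ proved: (A) is now REDUCED to typed [IUTchI] §2 predicates at the level where they apply; (B) is an argument not
yet carried by any interface; (C) is B13.  No side is taken on [IUTchIII] Cor 3.12.
-/

namespace Literature.IUT.HodgeArakelov

open Literature.IUT.HodgeTheaters
open Literature.AnabelianGeometry.AbsoluteAnabelian (IsNormallyTerminal)
open scoped Pointwise

universe u

namespace PlusMinusTower

section GroupTheory

variable {G G' : Type u} [Group G] [Group G']

/-- `I.map (MulAut.conj γ).toMonoidHom` is the pointwise conjugate `MulAut.conj γ • I` (definitional).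
[folklore] -/
private theorem map_conj_eq_smul' (I : Subgroup G) (γ : G) :
    I.map (MulAut.conj γ).toMonoidHom = MulAut.conj γ • I := rfl

/-- Transport of conjugates along an isomorphism out of a subgroup `Q ⊆ G` (abc-iut-L6-t7's `map_subgroupOf_conj`,
re-proved privately: the B13 file is not yet importable). [folklore] -/
private theorem map_subgroupOf_conj' {Q : Subgroup G} (e : Q ≃* G') (I : Subgroup G) {γ : G} (hγ : γ ∈ Q) :
    ((MulAut.conj γ • I).subgroupOf Q).map e.toMonoidHom =
      MulAut.conj (e ⟨γ, hγ⟩) • (I.subgroupOf Q).map e.toMonoidHom := by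
  ext y
  simp only [Subgroup.mem_map, Subgroup.mem_subgroupOf, MulEquiv.coe_toMonoidHom,
    Subgroup.mem_pointwise_smul_iff_inv_smul_mem, MulAut.smul_def, MulAut.conj_inv_apply]
  constructor
  · rintro ⟨q, hq, rfl⟩
    refine ⟨⟨γ⁻¹ * q * γ, Q.mul_mem (Q.mul_mem (Q.inv_mem hγ) q.2) hγ⟩, hq, ?_⟩
    have : (⟨γ⁻¹ * ↑q * γ, Q.mul_mem (Q.mul_mem (Q.inv_mem hγ) q.2) hγ⟩ : Q) =
        ⟨γ, hγ⟩⁻¹ * q * ⟨γ, hγ⟩ := rfl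
    rw [this, map_mul, map_mul, map_inv]
  · rintro ⟨q, hq, hqe⟩
    have hmem : γ * ↑q * γ⁻¹ ∈ Q := Q.mul_mem (Q.mul_mem hγ q.2) (Q.inv_mem hγ)
    refine ⟨⟨γ * q * γ⁻¹, hmem⟩, ?_, ?_⟩
    · show γ⁻¹ * (γ * ↑q * γ⁻¹) * γ ∈ I
      simpa [mul_assoc] using hq
    · have : (⟨γ * ↑q * γ⁻¹, hmem⟩ : Q) = ⟨γ, hγ⟩ * q * ⟨γ, hγ⟩⁻¹ := rfl
      rw [this, map_mul, map_mul, map_inv, hqe]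
      group

/-- Monotonicity of the transport. [folklore] -/
private theorem map_subgroupOf_mono' {Q : Subgroup G} (e : Q ≃* G') {I J : Subgroup G} (h : I ≤ J) :
    (I.subgroupOf Q).map e.toMonoidHom ≤ (J.subgroupOf Q).map e.toMonoidHom :=
  Subgroup.map_mono fun _ hq => h hq

/-- A normally terminal subgroup contains every element that conjugates it onto itself. [folklore] -/
private theorem mem_of_conj_smul_eq' {K : Subgroup G'} (hK : IsNormallyTerminal K) {g : G'}
    (h : MulAut.conj g • K = K) : g ∈ K := by
  rw [← hK.normalizer_eq, Subgroup.mem_normalizer_iff]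
  intro x
  rw [← SetLike.ext_iff.mp h (g * x * g⁻¹), Subgroup.mem_pointwise_smul_iff_inv_smul_mem]
  simp [MulAut.smul_def, mul_assoc]

/-- Membership read through the transport: if `(K ∩ Q) ↦ R` under `e : Q ⥲ G'`, then for `g ∈ Q`,
`g ∈ K ↔ e g ∈ R`. [folklore] -/
private theorem mem_iff_of_map_subgroupOf_eq {Q : Subgroup G} (e : Q ≃* G') {K : Subgroup G} {R : Subgroup G'}
    (hKR : (K.subgroupOf Q).map e.toMonoidHom = R) (g : Q) : (g : G) ∈ K ↔ e g ∈ R := by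
  rw [← hKR, Subgroup.mem_map]
  constructor
  · intro hg
    exact ⟨g, Subgroup.mem_subgroupOf.mpr hg, rfl⟩
  · rintro ⟨q, hq, hqe⟩
    rw [MulEquiv.coe_toMonoidHom, e.apply_eq_iff_eq] at hqe
    subst hqe
    exact Subgroup.mem_subgroupOf.mp hq

end GroupTheory

variable {S : BadPlaceSetting.{u}} {P : TopGroup.{u}} {T : TemperedCoverings S P}
  (W : PlusMinusTower T) (C : CuspidalInertiaData W) (Dflat : StableCurveTemperedData.{u})

/-- **IUTchI:Cor2.5 at the `X̲̲_v`-level** (kurims I p. 51; applied in [IUTchII] Cor 2.4 (i), p. 70 l. −4): given an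
identification `e : Π̂_v ⥲ Π̂_{X̲̲_v}` of abc-iut-L6-t1's `Π̂_v ⊆ Π̂^cor_v` with abc-iut-L5-t1's `Π̂_X` for `X = X̲̲_v`, carrying
`Π_v` onto (the image of) `Π^tp_{X̲̲_v}` (`hmap`) and each `Π_v`-cuspidal inertia group onto a `Π^tp_{X̲̲_v}`-conjugate of
some representative `I_x` (`hinertia`), the typed Cor. 2.5 (`Cor25Inertia`, for `Σ̂ = Primes`) and the normal
terminality of `Π^tp_{X̲̲_v}` in `Π̂_{X̲̲_v}` — HYPOTHESES — yield: for every `Π_v`-cuspidal inertia group `I` and every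
`γ'' ∈ Δ̂_v`, "`I^{γ''} ⊆ Π_v` implies `γ'' ∈ Π_v`".  PROVED (abc-iut-L6-t7's B13 transport, run one level down).
([IUTchII] Cor 2.4 (i) p.70) [claim: Mochizuki2012, status: disputed] -/
theorem h25flat_of_hatData (e : W.hat ≃* Dflat.PiHat)
    (hmap : (W.piV.subgroupOf W.hat).map e.toMonoidHom = Dflat.ιX.range)
    (hinertia : ∀ I : Subgroup W.Corhat, C.IsCuspidalInertia W.piV I →
      ∃ (x : Dflat.Cusp) (t : Dflat.PiTp), (I.subgroupOf W.hat).map e.toMonoidHom =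
        (MulAut.conj t • (Dflat.inertiaTp x).map Dflat.DeltaTp.subtype).map Dflat.ιX)
    (hSig : Dflat.graph.SigmaHat = {q | q.Prime}) (h25D : Dflat.Cor25Inertia)
    (hNT : IsNormallyTerminal Dflat.ιX.range) {I : Subgroup W.Corhat} (hI : C.IsCuspidalInertia W.piV I) :
    ∀ γ'' : W.Corhat, γ'' ∈ W.hat ⊓ W.aug.ker →
      I.map (MulAut.conj γ'').toMonoidHom ≤ W.piV → γ'' ∈ W.piV := by
  intro γ'' hγ'' hc
  obtain ⟨x, t, hIx⟩ := hinertia I hI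
  have hγ''hat : γ'' ∈ W.hat := (Subgroup.mem_inf.mp hγ'').1
  set g : Dflat.PiHat := e ⟨γ'', hγ''hat⟩ with hg
  -- transport `I^{γ''} ⊆ Π_v` along `e`
  have hle : MulAut.conj g • ((MulAut.conj t • (Dflat.inertiaTp x).map Dflat.DeltaTp.subtype).map Dflat.ιX) ≤
      Dflat.ιX.range := by
    rw [← hIx, hg, ← map_subgroupOf_conj' e I hγ''hat, ← hmap, ← map_conj_eq_smul']
    exact map_subgroupOf_mono' e hc
  -- Cor 2.5 for `X̲̲_v`: a conjugate of `Π^tp` containing a tempered cuspidal inertia group is `Π^tp`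
  have heq : MulAut.conj g⁻¹ • Dflat.ιX.range = Dflat.ιX.range := by
    refine (h25D.conj_eq_iff hSig g⁻¹).mp ⟨x, t, ?_⟩
    rwa [map_inv, ← Subgroup.pointwise_smul_subset_iff]
  -- normal terminality: `g⁻¹`, hence `g`, lies in `Π^tp`
  have hg' : g ∈ Dflat.ιX.range := by
    have := mem_of_conj_smul_eq' hNT heq
    simpa using Dflat.ιX.range.inv_mem this
  exact (mem_iff_of_map_subgroupOf_eq e hmap ⟨γ'', hγ''hat⟩).mpr hg'

/-- **IUTchII:Cor2.4(i)** — hypothesis `h25` of `cor24_i_of_inputs` ("by [IUTchI], Corollary 2.5 …, the inclusion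
`I^{γ'}_t ⊆ Π^±_{v□} ⊆ Π^±_v` implies that `γ' ∈ Δ^±_v`", p. 70, `γ' ∈ Δ̂^±_v`) for the PRINTED `I_t ⊆ Π_v`
(`C.IsCuspidalInertia W.piV I`), from: the `X̲̲_v`-level identification data + typed Cor. 2.5 / Prop. 2.4 (iii) for `X̲̲_v`
(hypotheses, as in `h25flat_of_hatData`), `Π^±_v ∩ Π̂_v ⊆ Π_v` (`hinf`) and `Δ^±_v ⊄ Δ̂_v` (`hnot`).  PROVED
(`h25flat_of_hatData` + `h25_of_hatLevel'`). ([IUTchII] Cor 2.4 (i) p.70) [claim: Mochizuki2012, status: disputed] -/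
theorem h25_of_hatData (e : W.hat ≃* Dflat.PiHat)
    (hmap : (W.piV.subgroupOf W.hat).map e.toMonoidHom = Dflat.ιX.range)
    (hinertia : ∀ I : Subgroup W.Corhat, C.IsCuspidalInertia W.piV I →
      ∃ (x : Dflat.Cusp) (t : Dflat.PiTp), (I.subgroupOf W.hat).map e.toMonoidHom =
        (MulAut.conj t • (Dflat.inertiaTp x).map Dflat.DeltaTp.subtype).map Dflat.ιX)
    (hSig : Dflat.graph.SigmaHat = {q | q.Prime}) (h25D : Dflat.Cor25Inertia) (h24 : Dflat.Prop24iii)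
    (hinf : W.piPM ⊓ W.hat ≤ W.piV) (hnot : ¬ (W.piPM ⊓ W.aug.ker ≤ W.hat))
    {I : Subgroup W.Corhat} (hI : C.IsCuspidalInertia W.piV I) :
    ∀ γ' : W.Corhat, γ' ∈ W.pmHat ⊓ W.aug.ker →
      I.map (MulAut.conj γ').toMonoidHom ≤ W.piPM → γ' ∈ W.piPM :=
  W.h25_of_hatLevel' I (C.le_of_isCuspidalInertia hI)
    (W.h25flat_of_hatData C Dflat e hmap hinertia hSig h25D h24.pi.isNormallyTerminal hI) hinf hnot

end PlusMinusTower

section Assembly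

variable {S : BadPlaceSetting.{u}} {P : TopGroup.{u}} {T : TemperedCoverings S P}
  (W : PlusMinusTower T) (C : CuspidalInertiaData W) (Dflat : StableCurveTemperedData.{u})

/-- **IUTchII:Cor2.4(i)** for ANY `Π_{v□}` (the typed `Cor24_i W C H I`): from the `X̲̲_v`-level data and typed [IUTchI]
Cor. 2.5 / Prop. 2.4 (iii) (input (A), hypotheses), the two covering facts, and the printed inputs (B) `h23vi` (Cor. 2.3
(vi) on the finite index open subgroups — GAP-LEDGER G-w4d012-2) and (C) `h23v` (Cor. 2.3 (ii)+(v), abc-iut-L6-t7's B13)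
as hypotheses.  PROVED via abc-iut-w4-d012's `cor24_i_of_inputs`. ([IUTchII] Cor 2.4 (i) pp.70-71)
[claim: Mochizuki2012, status: disputed] -/
theorem cor24_i_of_hatData (H : Subgroup P) (I : Subgroup W.Corhat) (e : W.hat ≃* Dflat.PiHat)
    (hmap : (W.piV.subgroupOf W.hat).map e.toMonoidHom = Dflat.ιX.range)
    (hinertia : ∀ I : Subgroup W.Corhat, C.IsCuspidalInertia W.piV I →
      ∃ (x : Dflat.Cusp) (t : Dflat.PiTp), (I.subgroupOf W.hat).map e.toMonoidHom =
        (MulAut.conj t • (Dflat.inertiaTp x).map Dflat.DeltaTp.subtype).map Dflat.ιX)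
    (hSig : Dflat.graph.SigmaHat = {q | q.Prime}) (h25D : Dflat.Cor25Inertia) (h24 : Dflat.Prop24iii)
    (hinf : W.piPM ⊓ W.hat ≤ W.piV) (hnot : ¬ (W.piPM ⊓ W.aug.ker ≤ W.hat))
    (h23vi : ∀ γ' : W.Corhat, γ' ∈ W.piPM ⊓ W.aug.ker →
      I.map (MulAut.conj γ').toMonoidHom ≤ W.pmBox H → γ' ∈ closure (W.deltaPmBox H : Set W.Corhat))
    (h23v : ∀ γ' : W.Corhat, γ' ∈ W.piPM ⊓ W.aug.ker →
      γ' ∈ closure (W.deltaPmBox H : Set W.Corhat) → γ' ∈ W.deltaPmBox H) :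
    Literature.IUT.HodgeArakelov.Cor24_i W C H I := by
  intro hI hIΔ
  exact cor24_i_of_inputs W C H I
    (W.h25_of_hatData C Dflat e hmap hinertia hSig h25D h24 hinf hnot hI) h23vi h23v hI hIΔ

variable {D : EtaleThetaData S.toThetaSetting P} (Dec : SubgraphDecomposition S T D)
  {L : LabCuspStructure C} (Ld : LabelledDecomposition Dec L)

/-- **IUTchII:Cor2.4(i)′** — the decl of record `Cor24_i' Dec W C Ld I` (printed family `□ ∈ {•t, ▶}`): input (A)
DISCHARGED to typed [IUTchI] Cor. 2.5 / Prop. 2.4 (iii) at the `X̲̲_v`-level + the two covering facts; inputs (B)/(C) per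
admissible `Π_{v□}` as hypotheses (shape of abc-iut-w4-d012's `cor24_i'_of_inputs`).  PROVED.
([IUTchII] Cor 2.4 (i) pp.70-71) [claim: Mochizuki2012, status: disputed] -/
theorem cor24_i'_of_hatData (I : Subgroup W.Corhat) (e : W.hat ≃* Dflat.PiHat)
    (hmap : (W.piV.subgroupOf W.hat).map e.toMonoidHom = Dflat.ιX.range)
    (hinertia : ∀ I : Subgroup W.Corhat, C.IsCuspidalInertia W.piV I →
      ∃ (x : Dflat.Cusp) (t : Dflat.PiTp), (I.subgroupOf W.hat).map e.toMonoidHom =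
        (MulAut.conj t • (Dflat.inertiaTp x).map Dflat.DeltaTp.subtype).map Dflat.ιX)
    (hSig : Dflat.graph.SigmaHat = {q | q.Prime}) (h25D : Dflat.Cor25Inertia) (h24 : Dflat.Prop24iii)
    (hinf : W.piPM ⊓ W.hat ≤ W.piV) (hnot : ¬ (W.piPM ⊓ W.aug.ker ≤ W.hat))
    (h23 : ∀ H : Subgroup P, Cor24_family Dec Ld H →
      (∀ γ' : W.Corhat, γ' ∈ W.piPM ⊓ W.aug.ker →
          I.map (MulAut.conj γ').toMonoidHom ≤ W.pmBox H → γ' ∈ closure (W.deltaPmBox H : Set W.Corhat)) ∧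
        (∀ γ' : W.Corhat, γ' ∈ W.piPM ⊓ W.aug.ker →
          γ' ∈ closure (W.deltaPmBox H : Set W.Corhat) → γ' ∈ W.deltaPmBox H)) :
    Literature.IUT.HodgeArakelov.Cor24_i' Dec W C Ld I := by
  intro H hH hI hIΔ
  obtain ⟨h23vi, h23v⟩ := h23 H hH
  exact cor24_i_of_hatData W C Dflat H I e hmap hinertia hSig h25D h24 hinf hnot h23vi h23v hI hIΔ

end Assembly

end Literature.IUT.HodgeArakelov
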